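import Literature.ModelTheory.FiniteModelTheory.DescLayers
import Literature.ModelTheory.FiniteModelTheory.HopData
import Literature.ModelTheory.FiniteModelTheory.CohomologicalConsistencyThreeColouringProofs
import HarnessLib

/-!
# The size lemma for closures (Conneryd–Ghannane–Pang 2025, Lemma 6.7 = [CdRNPR25, Lemma 27])

Topic `Literature/ModelTheory/FiniteModelTheory`.  Bottom-up formalisation of the named fact
`connerydGhannanePang2025_thm_6_1`.  We PROVE that in a sparse bounded-degree graph, ordered by a
`χ`-ordering with `c` colours, the closure (`cl`, Def. 6.6) of a small set is small:

**`card_cl_le`.** If `G` is `(ℓ, ε)`-sparse with `ε(2c+3) ≤ 1/2`, degrees `≤ d` (`d ≥ 1`), the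
order is a `χ`-ordering of a proper colouring with colours `< c` (`c ≥ 1`), and
`|U| + (3|U|+1)(2c+3) ≤ ℓ`, then `|cl U| ≤ c·d^{c-1}·(|U| + (3|U|+1)(2c+3))`.

Printed statement ([CdRNPR25] Lemma 27, cited by the source as Lemma 6.7): `(ℓ, 1/3λ)`-sparse,
decreasing paths with `≤ λ` vertices, `|U| ≤ ℓ/25λ` ⇒ `cl U = Desc(Z)` with `|Z| ≤ 25|U|` (then
`|Desc Z|` is bounded by Obs. 3.5).  We follow the PROOF (the "thin set" potential argument of
Claims 28–29) with slightly different bookkeeping and constants: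

* ROUND (`round`): if `Y ⊇ U`, `Y ⊆ cl U`, and `W = Desc(Y)` (`desc G c Y`) is not closed, pick hop
  data `Q` w.r.t. `W` (`exists_hopData`), decreasing chains from `Y` to the base `b 0` and (if it
  lies in `W`) to the closing vertex, and set `Y' = Y ∪ chains ∪ inner(Q)`.  Then `Y' ⊆ cl U`
  (chains stay in `Desc(Y) ⊆ cl U`; `inner(Q) ⊆ cl U` by `HopData.mem_of_isClosed`),
  `|Y'| ≤ |Y| + 2c + 3`, and `|E(Y')| ≥ |E(Y)| + |Y' ∖ Y| + 1`: every new chain vertex `w` owns the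
  edge to a larger chain neighbour (injective: `w` is the smaller endpoint), the inner vertex
  `b k` owns the chain edge `b (k-1) ~ b k`, and the closing edge is extra (Claim 29).
* ITERATION (`Good`, `exists_good_or_closed`): after `n` rounds `|Y| ≤ |U| + n(2c+3)` and
  `|E(Y)| ≥ |Y| - |U| + n`; by sparsity this is impossible for `n = 3|U| + 1` (`not_good_last`),
  so some `Desc(Y)` with `Y` thin is closed, equals `cl U`, and Obs. 3.5 (`card_desc_le`) bounds it.

## References

* [ConnerydGhannanePang2025] arXiv:2511.17272, Lemma 6.7. READ.
* [CdRNPR25] arXiv:2503.17022, Lemma 27 with Claims 28, 29, Obs. 3.5. READ.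
-/

namespace Literature.ModelTheory.FiniteModelTheory

namespace ConnerydGhannanePang

open Finset

variable {V : Type*} [LinearOrder V] [Fintype V] {G : SimpleGraph V} [DecidableRel G.Adj]

/-! ### Chain-like sets -/

/-- A finite set in which every vertex outside `Y` has a LARGER neighbour inside the set (the
vertex set of a union of decreasing chains starting in `Y`). [folklore] -/
def IsChainLike (Y S : Finset V) : Prop :=
  ∀ w ∈ S, w ∉ Y → ∃ p ∈ S, G.Adj p w ∧ w < p

omit [Fintype V] [DecidableRel G.Adj] in
/-- The vertex set of a decreasing chain from `Y` is chain-like. [folklore] -/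
theorem isChainLike_chain {Y : Finset V} {t : ℕ} {v : V} {w : ℕ → V} (hw : IsDecChain G Y t v w) :
    IsChainLike (G := G) Y ((Finset.range (t + 1)).image w) := by
  intro x hx hxY
  obtain ⟨i, hi, rfl⟩ := Finset.mem_image.1 hx
  have hit : i ≤ t := Nat.lt_succ_iff.1 (Finset.mem_range.1 hi)
  rcases Nat.eq_zero_or_pos i with rfl | hipos
  · exact absurd hw.1 hxY
  · obtain ⟨j, rfl⟩ : ∃ j, i = j + 1 := ⟨i - 1, by omega⟩
    have h := hw.2.2 j (by omega)
    exact ⟨w j, Finset.mem_image.2 ⟨j, Finset.mem_range.2 (by omega), rfl⟩, h.1, h.2⟩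

omit [Fintype V] [DecidableRel G.Adj] in
/-- Unions of chain-like sets are chain-like. [folklore] -/
theorem IsChainLike.union {Y S T : Finset V} (hS : IsChainLike (G := G) Y S) (hT : IsChainLike (G := G) Y T) :
    IsChainLike (G := G) Y (S ∪ T) := by
  intro w hw hwY
  rcases Finset.mem_union.1 hw with h | h
  · obtain ⟨p, hp, hpw, hlt⟩ := hS w h hwY
    exact ⟨p, Finset.mem_union_left _ hp, hpw, hlt⟩
  · obtain ⟨p, hp, hpw, hlt⟩ := hT w h hwY
    exact ⟨p, Finset.mem_union_right _ hp, hpw, hlt⟩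

/-- **Edge count of a chain-like set**: the vertices of a chain-like `S` outside `Y` inject into
the edges inside `S` not inside `Y` (each owns the edge to a larger neighbour; `w` is recovered as
the smaller endpoint). [cite: ConnerydGhannanePang2025, Lemma 6.7 (proof via [CdRNPR25, Claim 29])] -/
theorem IsChainLike.card_sdiff_le {Y S : Finset V} (hS : IsChainLike (G := G) Y S) :
    (S \ Y).card ≤ ((edgesIn G S).filter fun e => ¬ ∀ a ∈ e, a ∈ Y).card := by
  classical
  choose! p hp hadj hlt using hS
  refine Finset.card_le_card_of_injOn (fun w => s(p w, w)) (fun w hw => ?_) ?_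
  · have hw := Finset.mem_sdiff.1 (Finset.mem_coe.1 hw)
    show s(p w, w) ∈ ((edgesIn G S).filter fun e => ¬ ∀ a ∈ e, a ∈ Y)
    rw [Finset.mem_filter, mem_edgesIn]
    refine ⟨⟨hadj w hw.1 hw.2, fun a ha => ?_⟩, fun hall => hw.2 (hall w (Sym2.mem_mk_right _ _))⟩
    rcases Sym2.mem_iff.1 ha with rfl | rfl
    · exact hp w hw.1 hw.2
    · exact hw.1
  · intro w hw w' hw' h
    have hw := Finset.mem_sdiff.1 (Finset.mem_coe.1 hw)
    have hw' := Finset.mem_sdiff.1 (Finset.mem_coe.1 hw')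
    have h : s(p w, w) = s(p w', w') := h
    rcases Sym2.eq_iff.1 h with ⟨-, h⟩ | ⟨h1, h2⟩
    · exact h
    · have a := hlt w hw.1 hw.2
      have b := hlt w' hw'.1 hw'.2
      rw [h1] at a
      rw [← h2] at b
      exact absurd (a.trans b) (lt_irrefl _)

/-! ### One round (Claims 28–29 of [CdRNPR25]) -/

section Round

variable {χ : V → ℕ} {c : ℕ}

/-- Every vertex of `Desc(Y)` lies in a chain-like subset of `Desc(Y)` with at most `c` vertices
(the vertex set of a decreasing chain from `Y`). [cite: ConnerydGhannanePang2025, Lemma 6.7 (proof via [CdRNPR25, Claim 28])] -/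
theorem exists_chainLike_of_mem_desc {Y : Finset V} {x : V} (hx : x ∈ desc G c Y) :
    ∃ S : Finset V, IsChainLike (G := G) Y S ∧ S ⊆ desc G c Y ∧ S.card ≤ c ∧ x ∈ S := by
  obtain ⟨t, ht, w, hw⟩ := exists_chain_of_mem_desc hx
  refine ⟨(Finset.range (t + 1)).image w, isChainLike_chain hw, ?_, ?_, ?_⟩
  · intro y hy
    obtain ⟨i, hi, rfl⟩ := Finset.mem_image.1 hy
    exact chain_mem_desc ht hw (Nat.lt_succ_iff.1 (Finset.mem_range.1 hi))
  · exact Finset.card_image_le.trans (by rw [Finset.card_range]; exact ht)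
  · exact Finset.mem_image.2 ⟨t, Finset.mem_range.2 (Nat.lt_succ_self t), hw.2.1⟩

/-- **One round of the closure process** (Claims 28–29): if `U ⊆ Y ⊆ cl U` and `Desc(Y)` is not
closed, `Y` extends inside `cl U` by at most `2c + 3` vertices while the number of edges grows by
at least the number of new vertices PLUS ONE. [cite: ConnerydGhannanePang2025, Lemma 6.7 (proof via [CdRNPR25, Claims 28–29])] -/
theorem round (hχ : IsChiOrdering G χ) (hc : ∀ v, χ v < c) (hc1 : 1 ≤ c) {U Y : Finset V}
    (hY : Y ⊆ cl G U) (hnot : ¬ IsClosed G (desc G c Y)) :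
    ∃ Y' : Finset V, Y ⊆ Y' ∧ Y' ⊆ cl G U ∧ Y'.card ≤ Y.card + (2 * c + 3) ∧
      (edgesIn G Y).card + (Y' \ Y).card + 1 ≤ (edgesIn G Y').card := by
  classical
  set W := desc G c Y with hW
  have hWdesc : IsDescClosed G W := hχ.isDescClosed_desc hc Y
  have hYW : Y ⊆ W := subset_desc hc1 Y
  have hWcl : W ⊆ cl G U := desc_subset_of_isDescClosed hY (isClosed_cl U).desc
  obtain ⟨Q⟩ := exists_hopData hWdesc hnot
  -- chains to the base and (if in `W`) to the closing vertex
  obtain ⟨A, hAchain, hAW, hAcard, haA⟩ := exists_chainLike_of_mem_desc (G := G) Q.base_mem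
  obtain ⟨B, hBchain, hBW, hBcard, hzB⟩ : ∃ B : Finset V, IsChainLike (G := G) Y B ∧ B ⊆ W ∧
      B.card ≤ c ∧ (Q.z ∈ W → Q.z ∈ B) := by
    by_cases hz : Q.z ∈ W
    · obtain ⟨B, h1, h2, h3, h4⟩ := exists_chainLike_of_mem_desc (G := G) hz
      exact ⟨B, h1, h2, h3, fun _ => h4⟩
    · exact ⟨∅, fun w hw => by simp at hw, Finset.empty_subset _, by simp, fun h => absurd h hz⟩
  -- the inner vertices
  set I := (Finset.Icc 1 Q.r).image Q.b with hI
  have hIW : ∀ x ∈ I, x ∉ W := by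
    intro x hx
    obtain ⟨k, hk, rfl⟩ := Finset.mem_image.1 hx
    rw [Finset.mem_Icc] at hk
    exact Q.not_mem k hk.1 hk.2
  have hIcl : I ⊆ cl G U := by
    intro x hx
    obtain ⟨k, hk, rfl⟩ := Finset.mem_image.1 hx
    exact Q.mem_of_isClosed (isClosed_cl U) hWcl k (Finset.mem_Icc.1 hk).2
  set Y' := Y ∪ (A ∪ B) ∪ I with hY'
  have hAB : IsChainLike (G := G) Y (A ∪ B) := hAchain.union hBchain
  have hABW : A ∪ B ⊆ W := Finset.union_subset hAW hBW
  refine ⟨Y', Finset.subset_union_left.trans Finset.subset_union_left, ?_, ?_, ?_⟩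
  · -- inside `cl U`
    refine Finset.union_subset (Finset.union_subset hY (hABW.trans hWcl)) hIcl
  · -- few new vertices
    calc Y'.card ≤ (Y ∪ (A ∪ B)).card + I.card := Finset.card_union_le _ _
      _ ≤ (Y.card + (A ∪ B).card) + I.card := Nat.add_le_add_right (Finset.card_union_le _ _) _
      _ ≤ (Y.card + (A.card + B.card)) + I.card :=
          Nat.add_le_add_right (Nat.add_le_add_left (Finset.card_union_le _ _) _) _
      _ ≤ (Y.card + (c + c)) + 3 := by
          gcongr
          exact Finset.card_image_le.trans (by rw [Nat.card_Icc]; have := Q.le_three; omega)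
      _ = Y.card + (2 * c + 3) := by ring
  · -- many new edges: three disjoint families of new edges
    set EY := edgesIn G Y with hEY
    set EAB := (edgesIn G (A ∪ B)).filter (fun e => ¬ ∀ a ∈ e, a ∈ Y) with hEAB
    set EI := (Finset.Icc 1 Q.r).image (fun k => s(Q.b (k - 1), Q.b k)) with hEI
    set estar : Sym2 V := s(Q.b Q.r, Q.z) with hestar
    -- all lie inside `Y'`
    have hbY' : ∀ k ≤ Q.r, Q.b k ∈ Y' := by
      intro k hk
      rcases Nat.eq_zero_or_pos k with rfl | hk1
      · exact Finset.mem_union_left _ (Finset.mem_union_right _ (Finset.mem_union_left _ haA))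
      · exact Finset.mem_union_right _ (Finset.mem_image.2 ⟨k, Finset.mem_Icc.2 ⟨hk1, hk⟩, rfl⟩)
    have hzY' : Q.z ∈ Y' := by
      rcases Q.z_mem with hz | hz
      · exact Finset.mem_union_left _ (Finset.mem_union_right _ (Finset.mem_union_right _ (hzB hz)))
      · rw [hz]; exact hbY' 1 Q.one_le
    have hEY_sub : EY ⊆ edgesIn G Y' := by
      intro e he; rw [mem_edgesIn] at he ⊢
      exact ⟨he.1, fun a ha => Finset.mem_union_left _ (Finset.mem_union_left _ (he.2 a ha))⟩
    have hEAB_sub : EAB ⊆ edgesIn G Y' := by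
      intro e he
      rw [Finset.mem_filter, mem_edgesIn] at he
      rw [mem_edgesIn]
      exact ⟨he.1.1, fun a ha => Finset.mem_union_left _ (Finset.mem_union_right _ (he.1.2 a ha))⟩
    have hEI_sub : EI ⊆ edgesIn G Y' := by
      intro e he
      obtain ⟨k, hk, rfl⟩ := Finset.mem_image.1 he
      rw [Finset.mem_Icc] at hk
      rw [mem_edgesIn]
      refine ⟨?_, fun a ha => ?_⟩
      · have := Q.adj (k - 1) (by omega)
        rwa [Nat.sub_add_cancel hk.1] at this
      · rcases Sym2.mem_iff.1 ha with rfl | rfl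
        · exact hbY' _ (by omega)
        · exact hbY' _ hk.2
    have hstar_sub : estar ∈ edgesIn G Y' := by
      rw [mem_edgesIn]
      refine ⟨Q.close, fun a ha => ?_⟩
      rcases Sym2.mem_iff.1 ha with rfl | rfl
      · exact hbY' _ le_rfl
      · exact hzY'
    -- edges of `EY` and `EAB` have both endpoints in `W`; edges of `EI` and `estar` contain an
    -- inner vertex
    have hEY_W : ∀ e ∈ EY, ∀ a ∈ e, a ∈ W := fun e he a ha => hYW (((mem_edgesIn G).1 he).2 a ha)
    have hEAB_W : ∀ e ∈ EAB, ∀ a ∈ e, a ∈ W := fun e he a ha =>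
      hABW (((mem_edgesIn G).1 (Finset.mem_filter.1 he).1).2 a ha)
    have hEI_notW : ∀ e ∈ EI, ∃ a ∈ e, a ∉ W := by
      intro e he
      obtain ⟨k, hk, rfl⟩ := Finset.mem_image.1 he
      rw [Finset.mem_Icc] at hk
      exact ⟨Q.b k, Sym2.mem_mk_right _ _, Q.not_mem k hk.1 hk.2⟩
    have hstar_notW : ∃ a ∈ estar, a ∉ W :=
      ⟨Q.b Q.r, Sym2.mem_mk_left _ _, Q.not_mem Q.r Q.one_le le_rfl⟩
    -- pairwise disjointness
    have hd1 : Disjoint EY EAB := by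
      rw [Finset.disjoint_left]
      intro e he he'
      exact (Finset.mem_filter.1 he').2 ((mem_edgesIn G).1 he).2
    have hd2 : Disjoint (EY ∪ EAB) EI := by
      rw [Finset.disjoint_left]
      intro e he heI
      obtain ⟨a, ha, haW⟩ := hEI_notW e heI
      rcases Finset.mem_union.1 he with h | h
      · exact haW (hEY_W e h a ha)
      · exact haW (hEAB_W e h a ha)
    have hd3 : estar ∉ EY ∪ EAB ∪ EI := by
      intro h
      rcases Finset.mem_union.1 h with h | h
      · obtain ⟨a, ha, haW⟩ := hstar_notW
        rcases Finset.mem_union.1 h with h | h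
        · exact haW (hEY_W _ h a ha)
        · exact haW (hEAB_W _ h a ha)
      · obtain ⟨k, hk, hke⟩ := Finset.mem_image.1 h
        rw [Finset.mem_Icc] at hk
        have := Q.close_ne (k - 1) (by omega)
        rw [Nat.sub_add_cancel hk.1] at this
        exact this hke
    -- sizes
    have hEIcard : EI.card = Q.r := by
      rw [hEI, Finset.card_image_of_injOn, Nat.card_Icc, Nat.add_sub_cancel]
      intro j hj k hk hjk
      rw [Finset.mem_coe, Finset.mem_Icc] at hj hk
      have hjk : s(Q.b (j - 1), Q.b j) = s(Q.b (k - 1), Q.b k) := hjk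
      rcases Sym2.eq_iff.1 hjk with ⟨-, h⟩ | ⟨h1, h2⟩
      · exact Q.inj j k hj.2 hk.2 h
      · have e1 := Q.inj _ _ (by omega) hk.2 h1
        have e2 := Q.inj _ _ hj.2 (by omega) h2
        omega
    have hIcard : I.card ≤ Q.r :=
      Finset.card_image_le.trans (by rw [Nat.card_Icc, Nat.add_sub_cancel])
    have hABcard : ((A ∪ B) \ Y).card ≤ EAB.card := hAB.card_sdiff_le
    -- `Y' \ Y ⊆ I ∪ ((A ∪ B) \ Y)`
    have hnew : (Y' \ Y).card ≤ Q.r + EAB.card := by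
      calc (Y' \ Y).card ≤ (I ∪ ((A ∪ B) \ Y)).card := Finset.card_le_card (by
              intro x hx
              rw [Finset.mem_sdiff] at hx
              rcases Finset.mem_union.1 hx.1 with h | h
              · rcases Finset.mem_union.1 h with h | h
                · exact absurd h hx.2
                · exact Finset.mem_union_right _ (Finset.mem_sdiff.2 ⟨h, hx.2⟩)
              · exact Finset.mem_union_left _ h)
        _ ≤ I.card + ((A ∪ B) \ Y).card := Finset.card_union_le _ _
        _ ≤ Q.r + EAB.card := Nat.add_le_add hIcard hABcard
    -- the union of the four families sits inside `edgesIn G Y'`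
    have hunion : (insert estar (EY ∪ EAB ∪ EI)).card ≤ (edgesIn G Y').card := by
      refine Finset.card_le_card (Finset.insert_subset hstar_sub ?_)
      exact Finset.union_subset (Finset.union_subset hEY_sub hEAB_sub) hEI_sub
    rw [Finset.card_insert_of_notMem hd3, Finset.card_union_of_disjoint hd2,
      Finset.card_union_of_disjoint hd1, hEIcard] at hunion
    omega

end Round

/-! ### Iteration and the size bound -/

section Iterate

variable {χ : V → ℕ} {c : ℕ} {U : Finset V}

/-- The bookkeeping after `n` rounds: a thin set `Y` between `U` and `cl U` with at most
`|U| + n(2c+3)` vertices and at least `|Y| - |U| + n` edges. [cite: ConnerydGhannanePang2025, Lemma 6.7 (proof via [CdRNPR25, Claim 29])] -/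
def Good (G : SimpleGraph V) [DecidableRel G.Adj] (U : Finset V) (c n : ℕ) (Y : Finset V) : Prop :=
  U ⊆ Y ∧ Y ⊆ cl G U ∧ Y.card ≤ U.card + n * (2 * c + 3) ∧ Y.card + n ≤ U.card + (edgesIn G Y).card

/-- Round `0`: `Y = U`. [folklore] -/
theorem good_zero : Good G U c 0 U :=
  ⟨Finset.Subset.rfl, subset_cl U, by omega, by omega⟩

/-- A round preserves the bookkeeping. [cite: ConnerydGhannanePang2025, Lemma 6.7 (proof)] -/
theorem good_succ (hχ : IsChiOrdering G χ) (hc : ∀ v, χ v < c) (hc1 : 1 ≤ c) {n : ℕ} {Y : Finset V}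
    (h : Good G U c n Y) (hnot : ¬ IsClosed G (desc G c Y)) : ∃ Y', Good G U c (n + 1) Y' := by
  obtain ⟨Y', hYY', hY'cl, hcard, hedges⟩ := round hχ hc hc1 h.2.1 hnot
  refine ⟨Y', h.1.trans hYY', hY'cl, ?_, ?_⟩
  · have := h.2.2.1
    calc Y'.card ≤ Y.card + (2 * c + 3) := hcard
      _ ≤ U.card + n * (2 * c + 3) + (2 * c + 3) := Nat.add_le_add_right this _
      _ = U.card + (n + 1) * (2 * c + 3) := by ring
  · have h1 := h.2.2.2
    have h2 : Y'.card ≤ Y.card + (Y' \ Y).card := by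
      rw [← Finset.card_union_of_disjoint Finset.disjoint_sdiff]
      exact Finset.card_le_card (fun x hx => by
        rw [Finset.mem_union, Finset.mem_sdiff]; by_cases hxY : x ∈ Y <;> simp [hxY, hx])
    omega

/-- After at most `n` rounds either some thin `Y` has `Desc(Y)` closed, or the bookkeeping
continues. [cite: ConnerydGhannanePang2025, Lemma 6.7 (proof)] -/
theorem exists_good_or_closed (hχ : IsChiOrdering G χ) (hc : ∀ v, χ v < c) (hc1 : 1 ≤ c) :
    ∀ n, (∃ m ≤ n, ∃ Y, Good G U c m Y ∧ IsClosed G (desc G c Y)) ∨ ∃ Y, Good G U c n Y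
  | 0 => Or.inr ⟨U, good_zero⟩
  | n + 1 => by
    rcases exists_good_or_closed hχ hc hc1 n with ⟨m, hm, Y, hY, hcl⟩ | ⟨Y, hY⟩
    · exact Or.inl ⟨m, Nat.le_succ_of_le hm, Y, hY, hcl⟩
    · by_cases hcl : IsClosed G (desc G c Y)
      · exact Or.inl ⟨n, Nat.le_succ n, Y, hY, hcl⟩
      · exact Or.inr (good_succ hχ hc hc1 hY hcl)

/-- Sparsity stops the process: `3|U| + 1` rounds are impossible.
[cite: ConnerydGhannanePang2025, Lemma 6.7 (proof via [CdRNPR25, (5.3)–(5.4)])] -/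
theorem not_good_last {ℓ : ℕ} {ε : ℝ} (hε : 0 ≤ ε) (hε' : ε * (2 * c + 3) ≤ 1 / 2)
    (hG : IsSparse G ℓ ε) (hU : U.card + (3 * U.card + 1) * (2 * c + 3) ≤ ℓ) {Y : Finset V}
    (h : Good G U c (3 * U.card + 1) Y) : False := by
  obtain ⟨-, -, hcard, hedges⟩ := h
  have hYℓ : Y.card ≤ ℓ := hcard.trans hU
  have hsparse := hG Y hYℓ
  -- real arithmetic
  have e1 : ((Y.card + (3 * U.card + 1) : ℕ) : ℝ) ≤ ((U.card + (edgesIn G Y).card : ℕ) : ℝ) := by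
    exact_mod_cast hedges
  have e2 : ((Y.card : ℕ) : ℝ) ≤ ((U.card + (3 * U.card + 1) * (2 * c + 3) : ℕ) : ℝ) := by
    exact_mod_cast hcard
  push_cast at e1 e2
  have hc3 : (1 : ℝ) ≤ 2 * c + 3 := by
    have : (0 : ℝ) ≤ c := Nat.cast_nonneg c
    linarith
  have hε1 : ε ≤ 1 / 2 := by nlinarith
  nlinarith [mul_nonneg hε (Nat.cast_nonneg Y.card), mul_nonneg hε (Nat.cast_nonneg U.card)]

/-- **The size lemma** (Conneryd–Ghannane–Pang Lemma 6.7 = [CdRNPR25, Lemma 27] with Obs. 3.5):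
in an `(ℓ, ε)`-sparse graph with `ε(2c+3) ≤ 1/2`, degrees `≤ d` (`d ≥ 1`), ordered by a
`χ`-ordering of a proper colouring with colours `< c`, every `U` with
`|U| + (3|U|+1)(2c+3) ≤ ℓ` has `|cl U| ≤ c·d^{c-1}·(|U| + (3|U|+1)(2c+3))`.
[cite: ConnerydGhannanePang2025, Lemma 6.7] -/
theorem card_cl_le (hχ : IsChiOrdering G χ) (hc : ∀ v, χ v < c) (hc1 : 1 ≤ c) {d : ℕ} (hd1 : 1 ≤ d)
    (hd : ∀ v, G.degree v ≤ d) {ℓ : ℕ} {ε : ℝ} (hε : 0 ≤ ε) (hε' : ε * (2 * c + 3) ≤ 1 / 2)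
    (hG : IsSparse G ℓ ε) (U : Finset V) (hU : U.card + (3 * U.card + 1) * (2 * c + 3) ≤ ℓ) :
    (cl G U).card ≤ c * d ^ (c - 1) * (U.card + (3 * U.card + 1) * (2 * c + 3)) := by
  rcases exists_good_or_closed (U := U) hχ hc hc1 (3 * U.card + 1) with ⟨m, hm, Y, hY, hcl⟩ | ⟨Y, hY⟩
  · have hUY : U ⊆ desc G c Y := hY.1.trans (subset_desc hc1 Y)
    calc (cl G U).card ≤ (desc G c Y).card := Finset.card_le_card (cl_subset hUY hcl)
      _ ≤ c * d ^ (c - 1) * Y.card := card_desc_le hd1 hd c Y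
      _ ≤ c * d ^ (c - 1) * (U.card + m * (2 * c + 3)) := Nat.mul_le_mul_left _ hY.2.2.1
      _ ≤ c * d ^ (c - 1) * (U.card + (3 * U.card + 1) * (2 * c + 3)) :=
          Nat.mul_le_mul_left _ (Nat.add_le_add_left (Nat.mul_le_mul_right _ hm) _)
  · exact (not_good_last hε hε' hG hU hY).elim

end Iterate

end ConnerydGhannanePang

end Literature.ModelTheory.FiniteModelTheory
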